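import Summits.KontsevichZagierPeriods.KontsevichZagierPeriods.Theorems.HurwitzMicroSectorsHurwitzSectorComplementStubArcDissectionAux
import Literature.NumberTheory.Transcendental.KZSemiCanonicalReductionProofs

/-!
# `HurwitzSectorComplement` (stmt-KontsevichZagierPeriods-14341, route HurwitzMicroSectors),
# line `chebyshev-level-deformation`: stub `stub_arcDissection` (S3) — the two arc dissections

With `Δ m V = {v : ℝ^m | V > v₀ > ⋯ > v_{m−1} > 0}` carrying the symmetric weight `∏ g(vᵢ)`,
`g(v) = 2/(1+v²)`, and `V > 0` real-algebraic:

* (i) INSERTION (`ArcDissection.prod_arc_sub_smul_mem_relations`):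
  `[Δ m V, ∏g] · [(0,V), g] − (m+1) • [Δ (m+1) V, ∏g] ∈ KZ.relations`. The product domain
  (`KZ.IntegralRep.prod`, new coordinate last) is, off the null tie walls `{y = vᵢ}`, the disjoint
  union of the `m+1` insertion cells `{w | w ∘ e_p ∈ Δ (m+1) V}` (iterated rule (1a),
  `KZ.of_sub_sum_of_mem_relations`); on a cell the product integrand is the symmetric `∏ g`, so
  the cell is ONE coordinate permutation (rule (2), `KZ.of_sub_of_reindex_mem_relations`) of the
  simplex representation.
* (ii) BOTTOM REGION (`ArcDissection.two_smul_bottom_sub_mem_relations`): for the region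
  `B(j,V) = {chain V > v₀ > ⋯ > v_{j−1} > 0 in the slots natAdd 1 i, W = y (castAdd j 0) > v_{j−1}}`
  with weight `(∏ g(vᵢ))·1/(1+W²)`:
  `2 • [B(j,V)] − j • [Δ (1+j) V, ∏g] − [(V,∞), g] · [Δ j V, ∏g] ∈ KZ.relations`. After the block
  flip `finAddFlip` (rule (2)) the `W`-slot is last; off the null walls `{W = V} ∪ {W = vᵢ}` the
  region is the disjoint union of the `j` bounded insertion cells (`W < V`) and the tail
  `Δ j V × (V, ∞)` (rule (1a)); twice a bounded cell is the simplex representation since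
  `2/(1+W²) = g(W)` (rule (1b) + rule (2)), twice the tail is the product representation
  (rule (1b), `KZ.IntegralRep.prod_integrand_eq`), flipped back by `KZ.IntegralRep.prod_eq_reindex_prod`.

The cell combinatorics, null walls and the existence of the simplex / ray representations are in
the auxiliary file `…StubArcDissectionAux.lean`.

References: M. Kontsevich, D. Zagier, *Periods* (2001), §1.2 rules (1), (2).
-/

noncomputable section

open Set MeasureTheory
open scoped BigOperators
open Literature.NumberTheory.Transcendental

namespace Summit.KontsevichZagierPeriods.Theorems.HurwitzMicroSectorsHurwitzSectorComplement

namespace ArcDissection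

variable {Δ : (m : ℕ) → ℝ → Set (Fin m → ℝ)} {V : ℝ} {g : ℝ → ℝ}

/-- **Dissection (i).** `[Δ k V, ∏g] · [(0,V), g] ≡ (k+1) • [Δ (k+1) V, ∏g]`: off the null tie
walls the product domain is the disjoint union of the `k+1` insertion cells (iterated rule (1a),
`KZ.of_sub_sum_of_mem_relations`), and each cell, with the symmetric integrand `∏ g`, is one
coordinate permutation (rule (2), `KZ.of_sub_of_reindex_mem_relations`) of the simplex
representation. [cite: KontsevichZagier2001, §1.2 rules (1), (2)] -/
theorem prod_arc_sub_smul_mem_relations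
    (hΔ : ∀ m V v, v ∈ Δ m V ↔ StrictAnti (Fin.cons V v : Fin (m + 1) → ℝ) ∧
      0 < (Fin.cons V v : Fin (m + 1) → ℝ) (Fin.last m))
    (hV : 0 < V) (k : ℕ) (s : KZ.IntegralRep k) (a : KZ.IntegralRep 1)
    (S : KZ.IntegralRep (k + 1))
    (hs : s.domain = Δ k V) (hsi : EqOn s.integrand (fun v => ∏ i, g (v i)) s.domain)
    (ha : a.domain = {y | 0 < y 0 ∧ y 0 < V}) (hai : EqOn a.integrand (fun y => g (y 0)) a.domain)
    (hS : S.domain = Δ (k + 1) V) (hSi : EqOn S.integrand (fun v => ∏ i, g (v i)) S.domain) :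
    KZ.of (s.prod a) - (k + 1) • KZ.of S ∈ KZ.relations := by
  classical
  choose e he1 he2 using fun p : Fin (k + 1) => exists_insPerm p
  -- membership in the product domain
  have hprod : ∀ w : Fin (k + 1) → ℝ, w ∈ (s.prod a).domain ↔
      (fun i => w (Fin.castSucc i)) ∈ Δ k V ∧ (0 < w (Fin.last k) ∧ w (Fin.last k) < V) := by
    intro w
    rw [KZ.IntegralRep.prod_domain, KZ.IntegralRep.mem_prodDomain, hs, ha, mem_setOf_eq]
    simp only [natAdd_zero_eq_last]
    exact Iff.rfl
  -- membership in the cells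
  have hcell : ∀ p (w : Fin (k + 1) → ℝ), w ∈ (S.reindex (e p)).domain ↔
      (fun i => w (Fin.castSucc i)) ∈ Δ k V ∧ (0 < w (Fin.last k) ∧ w (Fin.last k) < V) ∧
      (∀ i, Fin.castSucc i < p → w (Fin.last k) < w (Fin.castSucc i)) ∧
      (∀ i, p ≤ Fin.castSucc i → w (Fin.castSucc i) < w (Fin.last k)) := by
    intro p w
    rw [KZ.IntegralRep.reindex_domain, mem_setOf_eq, hS]
    exact comp_mem_Δ_iff hΔ hV p (e p) (he1 p) (he2 p) w
  -- the dissection into cells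
  have hdis : KZ.of (s.prod a) - ∑ p, KZ.of (S.reindex (e p)) ∈ KZ.relations := by
    refine KZ.of_sub_sum_of_mem_relations Finset.univ (s.prod a) (fun p => S.reindex (e p))
      (fun p _ => ?_) (fun p _ => ?_) ?_ ?_
    · rw [Set.sdiff_eq_empty.mpr fun w hw =>
        (hprod w).2 ⟨((hcell p w).1 hw).1, ((hcell p w).1 hw).2.1⟩, measure_empty]
    · rintro w ⟨hw, hw'⟩
      have hmemS : (fun i => w (e p i)) ∈ S.domain := hw
      obtain ⟨h1, h2⟩ := (KZ.IntegralRep.mem_prodDomain s a w).1 hw'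
      show S.integrand (fun i => w (e p i)) = (s.prod a).integrand w
      rw [KZ.IntegralRep.prod_integrand_eq, KZ.IntegralRep.prodFun_apply, hSi hmemS, hsi h1,
        hai h2]
      show ∏ i, g (w (e p i)) = (∏ i : Fin k, g (w (Fin.castAdd 1 i))) * g (w (Fin.natAdd k 0))
      rw [Equiv.prod_comp (e p) (fun i => g (w i)), Fin.prod_univ_castSucc, natAdd_zero_eq_last]
      rfl
    · refine measure_mono_null (fun w hw => ?_) (volume_walls k V)
      obtain ⟨hw, hnot⟩ := hw
      by_contra hN
      simp only [mem_union, mem_iUnion, mem_setOf_eq, not_or, not_exists] at hN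
      obtain ⟨-, hne⟩ := hN
      obtain ⟨hx, hy⟩ := (hprod w).1 hw
      obtain ⟨p, hp⟩ := exists_cellCond ((mem_Δ_iff hΔ hV _).1 hx).1 hne
      exact hnot (mem_iUnion₂.2 ⟨p, Finset.mem_univ _, (hcell p w).2 ⟨hx, hy, hp⟩⟩)
    · intro p _ q _ hpq
      rw [show ((S.reindex (e p)).domain ∩ (S.reindex (e q)).domain : Set (Fin (k + 1) → ℝ)) = ∅
        from eq_empty_of_forall_notMem fun w hw =>
          hpq (eq_of_cellCond ((hcell p w).1 hw.1).2.2 ((hcell q w).1 hw.2).2.2), measure_empty]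
  -- each cell is a coordinate permutation of the simplex representation
  have hsum : ∑ p : Fin (k + 1), KZ.of (S.reindex (e p)) - ∑ _p : Fin (k + 1), KZ.of S ∈
      KZ.relations :=
    KZ.sum_sub_sum_mem_relations _ _ _ fun p _ => by
      rw [← neg_sub]
      exact KZ.relations.neg_mem (KZ.of_sub_of_reindex_mem_relations S (e p))
  have hcard : ∑ _p : Fin (k + 1), KZ.of S = (k + 1) • KZ.of S := by
    rw [Finset.sum_const, Finset.card_univ, Fintype.card_fin]
  have : KZ.of (s.prod a) - (k + 1) • KZ.of S =
      (KZ.of (s.prod a) - ∑ p, KZ.of (S.reindex (e p))) +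
        (∑ p, KZ.of (S.reindex (e p)) - ∑ _p : Fin (k + 1), KZ.of S) := by
    rw [hcard]; abel
  rw [this]
  exact KZ.relations.add_mem hdis hsum

/-- **Dissection (ii).** `2 • [B(k,V), (∏ g)/(1+W²)] ≡ k • [Δ (1+k) V, ∏g] + [(V,∞), g]·[Δ k V, ∏g]`:
after moving the `W`-slot last (a coordinate permutation, rule (2)), the bottom region is, off the
null walls `{W = V} ∪ {W = vᵢ}`, the disjoint union of the `k` bounded insertion cells
(`W` below `V`) and of the tail `{W > V} = Δ k V × (V, ∞)` (iterated rule (1a)); on a bounded cell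
`2 · (∏ g)/(1+W²) = ∏ g` over all `k+1` coordinates (rule (1b)), which is one coordinate
permutation of the simplex representation; on the tail `2 · (∏ g)/(1+W²)` is the product
integrand, and the product is flipped back (rule (2)). [cite: KontsevichZagier2001, §1.2 rules (1), (2)] -/
theorem two_smul_bottom_sub_mem_relations (hg : ∀ v, g v = 2 / (1 + v ^ 2))
    (hΔ : ∀ m V v, v ∈ Δ m V ↔ StrictAnti (Fin.cons V v : Fin (m + 1) → ℝ) ∧
      0 < (Fin.cons V v : Fin (m + 1) → ℝ) (Fin.last m))
    (hVa : IsAlgebraic ℚ V) (hV : 0 < V) (k : ℕ) (b : KZ.IntegralRep (1 + k))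
    (hb : b.domain = {y | StrictAnti (Fin.cons V (fun i : Fin k => y (Fin.natAdd 1 i)) :
        Fin (k + 1) → ℝ) ∧
      0 < (Fin.cons V (fun i : Fin k => y (Fin.natAdd 1 i)) : Fin (k + 1) → ℝ) (Fin.last k) ∧
      (Fin.cons V (fun i : Fin k => y (Fin.natAdd 1 i)) : Fin (k + 1) → ℝ) (Fin.last k) <
        y (Fin.castAdd k 0)})
    (hbi : EqOn b.integrand (fun y => (∏ i : Fin k, g (y (Fin.natAdd 1 i))) *
      (1 / (1 + y (Fin.castAdd k 0) ^ 2))) b.domain) :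
    ∃ (s' : KZ.IntegralRep (1 + k)) (t : KZ.IntegralRep 1) (s : KZ.IntegralRep k),
      s'.domain = Δ (1 + k) V ∧ EqOn s'.integrand (fun v => ∏ i, g (v i)) s'.domain ∧
      t.domain = {y | V < y 0} ∧ EqOn t.integrand (fun y => g (y 0)) t.domain ∧
      s.domain = Δ k V ∧ EqOn s.integrand (fun v => ∏ i, g (v i)) s.domain ∧
      2 • KZ.of b - k • KZ.of s' - KZ.of (t.prod s) ∈ KZ.relations := by
  classical
  obtain ⟨S, hS, hSi⟩ := exists_simplexRep hg hΔ hVa hV (k + 1)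
  obtain ⟨t, ht, hti⟩ := exists_rayRep hg hVa
  obtain ⟨s, hs, hsi⟩ := exists_simplexRep hg hΔ hVa hV k
  -- the required `s'` in dimension `1 + k` is `S` read along `Fin.cast`
  set s' : KZ.IntegralRep (1 + k) := S.reindex (finCongr (Nat.add_comm k 1)) with hs'_def
  have hs'd : s'.domain = Δ (1 + k) V := by
    rw [hs'_def, KZ.IntegralRep.reindex_domain, hS]
    exact setOf_comp_finCongr_mem (Nat.add_comm k 1) (fun n => Δ n V)
  have hs'i : EqOn s'.integrand (fun v => ∏ i, g (v i)) s'.domain := by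
    intro w _
    rw [hs'_def, KZ.IntegralRep.reindex_integrand, hSi]
    exact Equiv.prod_comp (finCongr (Nat.add_comm k 1)) (fun i => g (w i))
  have hSs' : KZ.of S - KZ.of s' ∈ KZ.relations := KZ.of_sub_of_reindex_mem_relations S _
  refine ⟨s', t, s, hs'd, hs'i, ht, fun y _ => by rw [hti], hs, fun v _ => by rw [hsi], ?_⟩
  -- transport `b` to `ℝ^{k+1}` with the `W`-slot last
  set bt : KZ.IntegralRep (k + 1) := b.reindex finAddFlip with hbt_def
  have hbbt : KZ.of b - KZ.of bt ∈ KZ.relations := KZ.of_sub_of_reindex_mem_relations b _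
  have hbt : ∀ w : Fin (k + 1) → ℝ, w ∈ bt.domain ↔
      (fun i => w (Fin.castSucc i)) ∈ Δ k V ∧
        (Fin.cons V (fun i => w (Fin.castSucc i)) : Fin (k + 1) → ℝ) (Fin.last k) <
          w (Fin.last k) := by
    intro w
    rw [hbt_def, KZ.IntegralRep.reindex_domain, mem_setOf_eq, hb, mem_setOf_eq, hΔ]
    simp only [finAddFlip_apply_natAdd, finAddFlip_apply_castAdd, natAdd_zero_eq_last, and_assoc]
    exact Iff.rfl
  have hbti : ∀ w ∈ bt.domain, bt.integrand w =
      (∏ i : Fin k, g (w (Fin.castSucc i))) * (1 / (1 + w (Fin.last k) ^ 2)) := by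
    intro w hw
    have hw' : (fun i => w (finAddFlip i)) ∈ b.domain := hw
    rw [hbt_def, KZ.IntegralRep.reindex_integrand]
    show b.integrand (fun i => w (finAddFlip i)) = _
    rw [hbi hw']
    simp only [finAddFlip_apply_natAdd, finAddFlip_apply_castAdd, natAdd_zero_eq_last]
    rfl
  -- the insertion cells (positions `castSucc q`, i.e. `W` below `V`) and the tail `W > V`
  choose e he1 he2 using fun p : Fin (k + 1) => exists_insPerm p
  have hcell : ∀ p (w : Fin (k + 1) → ℝ), w ∈ (S.reindex (e p)).domain ↔
      (fun i => w (Fin.castSucc i)) ∈ Δ k V ∧ (0 < w (Fin.last k) ∧ w (Fin.last k) < V) ∧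
      (∀ i, Fin.castSucc i < p → w (Fin.last k) < w (Fin.castSucc i)) ∧
      (∀ i, p ≤ Fin.castSucc i → w (Fin.castSucc i) < w (Fin.last k)) := by
    intro p w
    rw [KZ.IntegralRep.reindex_domain, mem_setOf_eq, hS]
    exact comp_mem_Δ_iff hΔ hV p (e p) (he1 p) (he2 p) w
  have hanti : ∀ x : Fin k → ℝ, x ∈ Δ k V → Antitone (Fin.cons V x : Fin (k + 1) → ℝ) :=
    fun x hx => ((hΔ k V x).1 hx).1.antitone
  have hCsub : ∀ q : Fin k, (S.reindex (e (Fin.castSucc q))).domain ⊆ bt.domain := by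
    intro q w hw
    obtain ⟨hx, -, -, h2⟩ := (hcell _ w).1 hw
    refine (hbt w).2 ⟨hx, ?_⟩
    calc (Fin.cons V (fun i => w (Fin.castSucc i)) : Fin (k + 1) → ℝ) (Fin.last k)
        ≤ (Fin.cons V (fun i => w (Fin.castSucc i)) : Fin (k + 1) → ℝ) q.succ :=
          hanti _ hx (Fin.le_last _)
      _ = w (Fin.castSucc q) := by simp
      _ < w (Fin.last k) := h2 q le_rfl
  have hTy : ∀ w, w ∈ (s.prod t).domain ↔
      (fun i => w (Fin.castSucc i)) ∈ Δ k V ∧ V < w (Fin.last k) := by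
    intro w
    rw [KZ.IntegralRep.prod_domain, KZ.IntegralRep.mem_prodDomain, hs, ht, mem_setOf_eq]
    simp only [natAdd_zero_eq_last]
    exact Iff.rfl
  have hTsub : (s.prod t).domain ⊆ bt.domain := by
    intro w hw
    obtain ⟨hx, hy⟩ := (hTy w).1 hw
    refine (hbt w).2 ⟨hx, ?_⟩
    calc (Fin.cons V (fun i => w (Fin.castSucc i)) : Fin (k + 1) → ℝ) (Fin.last k)
        ≤ (Fin.cons V (fun i => w (Fin.castSucc i)) : Fin (k + 1) → ℝ) 0 :=
          hanti _ hx (Fin.zero_le _)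
      _ = V := by simp
      _ < w (Fin.last k) := hy
  set Rc : Fin k → KZ.IntegralRep (k + 1) := fun q =>
    bt.restrict (S.reindex (e (Fin.castSucc q))).domain
      (S.reindex (e (Fin.castSucc q))).isSemialgebraic_domain (hCsub q) with hRc_def
  set Rt : KZ.IntegralRep (k + 1) :=
    bt.restrict (s.prod t).domain (s.prod t).isSemialgebraic_domain hTsub with hRt_def
  set R : Option (Fin k) → KZ.IntegralRep (k + 1) := fun o => Option.elim o Rt Rc with hR_def
  -- rule (1a): `[bt] ≡ [Rt] + ∑ [Rc q]`
  have hdis : KZ.of bt - ∑ o, KZ.of (R o) ∈ KZ.relations := by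
    refine KZ.of_sub_sum_of_mem_relations Finset.univ bt R (fun o _ => ?_) (fun o _ => ?_) ?_ ?_
    · have : (R o).domain ⊆ bt.domain := by
        cases o with
        | none => exact hTsub
        | some q => exact hCsub q
      rw [Set.sdiff_eq_empty.mpr this, measure_empty]
    · intro w _
      cases o <;> rfl
    · refine measure_mono_null (fun w hw => ?_) (volume_walls k V)
      obtain ⟨hw, hnot⟩ := hw
      by_contra hN
      simp only [mem_union, mem_iUnion, mem_setOf_eq, not_or, not_exists] at hN
      obtain ⟨hneV, hne⟩ := hN
      obtain ⟨hx, hlt⟩ := (hbt w).1 hw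
      apply hnot
      rcases lt_or_gt_of_ne hneV with hyV | hyV
      · have hy0 : 0 < w (Fin.last k) := ((hΔ k V _).1 hx).2.trans hlt
        obtain ⟨p, hp⟩ := exists_cellCond ((mem_Δ_iff hΔ hV _).1 hx).1 hne
        have hpl : p ≠ Fin.last k := by
          rintro rfl
          have hall : ∀ j : Fin (k + 1), w (Fin.last k) <
              (Fin.cons V (fun i => w (Fin.castSucc i)) : Fin (k + 1) → ℝ) j := by
            intro j
            refine Fin.cases ?_ (fun i => ?_) j
            · simpa using hyV
            · simpa using hp.1 i (Fin.castSucc_lt_last i)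
          exact lt_asymm (hall (Fin.last k)) hlt
        obtain ⟨q, rfl⟩ := Fin.exists_castSucc_eq.2 hpl
        exact mem_iUnion₂.2 ⟨some q, Finset.mem_univ _, (hcell _ w).2 ⟨hx, ⟨hy0, hyV⟩, hp⟩⟩
      · exact mem_iUnion₂.2 ⟨none, Finset.mem_univ _, (hTy w).2 ⟨hx, hyV⟩⟩
    · intro o _ o' _ hoo'
      rw [show ((R o).domain ∩ (R o').domain : Set (Fin (k + 1) → ℝ)) = ∅ from
        eq_empty_of_forall_notMem fun w hw => hoo' ?_, measure_empty]
      cases o with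
      | none =>
        cases o' with
        | none => rfl
        | some q' =>
          exact (lt_asymm ((hTy w).1 hw.1).2 (((hcell _ w).1 hw.2).2.1.2.trans_le le_rfl)).elim
      | some q =>
        cases o' with
        | none =>
          exact (lt_asymm ((hTy w).1 hw.2).2 (((hcell _ w).1 hw.1).2.1.2.trans_le le_rfl)).elim
        | some q' =>
          exact congrArg some (Fin.castSucc_injective _
            (eq_of_cellCond ((hcell _ w).1 hw.1).2.2 ((hcell _ w).1 hw.2).2.2))
  -- rule (1b) + rule (2): twice a bounded cell is the simplex representation
  have hRc2 : ∀ q, 2 • KZ.of (Rc q) - KZ.of S ∈ KZ.relations := by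
    intro q
    have h1 : KZ.of (S.reindex (e (Fin.castSucc q))) - KZ.of (Rc q) - KZ.of (Rc q) ∈
        KZ.relations := by
      refine KZ.integrandAddRel_subset_relations
        ⟨k + 1, S.reindex (e (Fin.castSucc q)), Rc q, Rc q, rfl, rfl, fun w hw => ?_, rfl⟩
      have hwbt : w ∈ bt.domain := hCsub q hw
      show S.integrand (fun i => w (e (Fin.castSucc q) i)) = bt.integrand w + bt.integrand w
      rw [hSi, hbti w hwbt]
      show ∏ i, g (w (e (Fin.castSucc q) i)) = _
      rw [Equiv.prod_comp (e (Fin.castSucc q)) (fun i => g (w i)), Fin.prod_univ_castSucc]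
      simp only [hg]
      ring
    have h2 := KZ.of_sub_of_reindex_mem_relations S (e (Fin.castSucc q))
    have : 2 • KZ.of (Rc q) - KZ.of S =
        -(KZ.of (S.reindex (e (Fin.castSucc q))) - KZ.of (Rc q) - KZ.of (Rc q)) -
          (KZ.of S - KZ.of (S.reindex (e (Fin.castSucc q)))) := by abel
    rw [this]
    exact KZ.relations.sub_mem (KZ.relations.neg_mem h1) h2
  -- rule (1b): twice the tail is the product `[Δ k V, ∏g] · [(V,∞), g]`
  have hRt2 : 2 • KZ.of Rt - KZ.of (s.prod t) ∈ KZ.relations := by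
    have h1 : KZ.of (s.prod t) - KZ.of Rt - KZ.of Rt ∈ KZ.relations := by
      refine KZ.integrandAddRel_subset_relations
        ⟨k + 1, s.prod t, Rt, Rt, rfl, rfl, fun w hw => ?_, rfl⟩
      have hwbt : w ∈ bt.domain := hTsub hw
      rw [KZ.IntegralRep.prod_integrand_eq, KZ.IntegralRep.prodFun_apply, hsi, hti]
      show (∏ i : Fin k, g (w (Fin.castSucc i))) * g (w (Fin.natAdd k 0)) =
        bt.integrand w + bt.integrand w
      rw [hbti w hwbt, natAdd_zero_eq_last, hg (w (Fin.last k))]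
      ring
    have : 2 • KZ.of Rt - KZ.of (s.prod t) = -(KZ.of (s.prod t) - KZ.of Rt - KZ.of Rt) := by abel
    rw [this]
    exact KZ.relations.neg_mem h1
  -- rule (2): flip the product back
  have hflip : KZ.of (s.prod t) - KZ.of (t.prod s) ∈ KZ.relations := by
    rw [KZ.IntegralRep.prod_eq_reindex_prod t s]
    exact KZ.of_sub_of_reindex_mem_relations (s.prod t) finAddFlip
  -- bookkeeping
  have hsumO : ∑ o, KZ.of (R o) = KZ.of Rt + ∑ q, KZ.of (Rc q) := Fintype.sum_option _
  have hcells : ∑ q : Fin k, (2 • KZ.of (Rc q) - KZ.of S) ∈ KZ.relations :=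
    sum_mem fun q _ => hRc2 q
  have hcells' : ∑ q : Fin k, (2 • KZ.of (Rc q) - KZ.of S) =
      2 • ∑ q, KZ.of (Rc q) - k • KZ.of S := by
    rw [Finset.sum_sub_distrib, Finset.sum_const, Finset.card_univ, Fintype.card_fin,
      ← Finset.smul_sum]
  have hSk : k • KZ.of S - k • KZ.of s' ∈ KZ.relations := by
    rw [← nsmul_sub]
    exact KZ.relations.nsmul_mem hSs' k
  have key : 2 • KZ.of b - k • KZ.of s' - KZ.of (t.prod s) =
      2 • (KZ.of b - KZ.of bt) + 2 • (KZ.of bt - ∑ o, KZ.of (R o)) +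
        (2 • ∑ q, KZ.of (Rc q) - k • KZ.of S) + (k • KZ.of S - k • KZ.of s') +
        (2 • KZ.of Rt - KZ.of (s.prod t)) + (KZ.of (s.prod t) - KZ.of (t.prod s)) := by
    rw [hsumO]
    abel
  rw [key]
  refine add_mem (add_mem (add_mem (add_mem (add_mem ?_ ?_) ?_) hSk) hRt2) hflip
  · exact KZ.relations.nsmul_mem hbbt 2
  · exact KZ.relations.nsmul_mem hdis 2
  · rw [← hcells']
    exact hcells

end ArcDissection

/-- **S3 (arc dissections).** With `Δ m V = {v : ℝ^m | V > v₀ > ⋯ > v_{m−1} > 0}` carrying the symmetric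
weight `∏ g(vᵢ)`, `g(v) = 2/(1+v²)`: (i) INSERTION — `[Δ m V] · [(0,V), g] ≡ (m+1) • [Δ (m+1) V]`
(the product splits, up to null hyperplanes, into the `m+1` order cells of the new coordinate, each
a coordinate permutation of the simplex); (ii) BOTTOM REGION —
`2 • [B(j,V), (∏ g)·1/(1+W²)] ≡ j • [Δ (1+j) V] + [(V,∞), g] · [Δ j V]` (`W` below `V`: `j` order
cells, each `≡ ½[Δ (1+j) V]` since `1/(1+W²) = g(W)/2`; `W` above `V`: a product).
[cite: KontsevichZagier2001, §1.2 rules (1), (2)] -/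
theorem stub_arcDissection : ∀ (g : ℝ → ℝ) (Δ : (m : ℕ) → ℝ → Set (Fin m → ℝ)), (∀ v, g v = 2 / (1 + v ^ 2)) → (∀ m V v, v ∈ Δ m V ↔ StrictAnti (Fin.cons V v : Fin (m + 1) → ℝ) ∧ 0 < (Fin.cons V v : Fin (m + 1) → ℝ) (Fin.last m)) → ∀ (V : ℝ), IsAlgebraic ℚ V → 0 < V → (∀ (m : ℕ) (s : KZ.IntegralRep m) (a : KZ.IntegralRep 1) (s' : KZ.IntegralRep (m + 1)), s.domain = Δ m V → Set.EqOn s.integrand (fun v => ∏ i, g (v i)) s.domain → a.domain = {y | 0 < y 0 ∧ y 0 < V} → Set.EqOn a.integrand (fun y => g (y 0)) a.domain → s'.domain = Δ (m + 1) V → Set.EqOn s'.integrand (fun v => ∏ i, g (v i)) s'.domain → KZ.of (s.prod a) - (m + 1) • KZ.of s' ∈ KZ.relations) ∧ (∀ (j : ℕ) (b : KZ.IntegralRep (1 + j)), b.domain = {y | StrictAnti (Fin.cons V (fun i : Fin j => y (Fin.natAdd 1 i)) : Fin (j + 1) → ℝ) ∧ 0 < (Fin.cons V (fun i : Fin j =>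 y (Fin.natAdd 1 i)) : Fin (j + 1) → ℝ) (Fin.last j) ∧ (Fin.cons V (fun i : Fin j => y (Fin.natAdd 1 i)) : Fin (j + 1) → ℝ) (Fin.last j) < y (Fin.castAdd j 0)} → Set.EqOn b.integrand (fun y => (∏ i : Fin j, g (y (Fin.natAdd 1 i))) * (1 / (1 + y (Fin.castAdd j 0) ^ 2))) b.domain → ∃ (s' : KZ.IntegralRep (1 + j)) (t : KZ.IntegralRep 1) (s : KZ.IntegralRep j), s'.domain = Δ (1 + j) V ∧ Set.EqOn s'.integrand (fun v => ∏ i, g (v i)) s'.domain ∧ t.domain = {y | V < y 0} ∧ Set.EqOn t.integrand (fun y => g (y 0)) t.domain ∧ s.domain = Δ j V ∧ Set.EqOn s.integrand (fun v => ∏ i, g (v i)) s.domain ∧ 2 • KZ.of b - j • KZ.of s' - KZ.of (t.prod s) ∈ KZ.relations) := by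
  intro g Δ hg hΔ V hVa hV
  refine ⟨fun m s a s' hs hsi ha hai hs' hs'i => ?_, fun j b hb hbi => ?_⟩
  · exact ArcDissection.prod_arc_sub_smul_mem_relations hΔ hV m s a s' hs hsi ha hai hs' hs'i
  · exact ArcDissection.two_smul_bottom_sub_mem_relations hg hΔ hVa hV j b hb hbi

end Summit.KontsevichZagierPeriods.Theorems.HurwitzMicroSectorsHurwitzSectorComplement

end
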